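import Literature.IUT.HodgeTheaters.KappaCoricRatGaloisClauseAGeom
import Literature.IUT.HodgeTheaters.KappaCoricRatGaloisRestrictionConstants
import Literature.IUT.HodgeTheaters.KappaCoricRatGaloisCritLocusGeom
import HarnessLib

/-!
# [IUTchI] Example 5.4 (iv), clause (a), GEOMETRIC typing — the bundled statement `ClauseAGeom S B`
# over a base-change square, PROVED, and its instances at the landed squares (GAP B item GB-06, part 2)

S. Mochizuki, *Inter-universal Teichmüller theory I*, §5, Ex. 5.4 (iv) (kurims manuscript May 2020,
p. 149: «restriction of associated Kummer classes … `{π₁^{rat}(†𝒟^⊛) ↷ †𝕄^⊛_{∞κ} → ‡𝕄_{∞κv} ⊆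
‡𝕄_{∞κ×v}}_{v∈𝕍}`») and §3, Rmk 3.1.7 (i), (ii) (pp. 66–67) [claim: Mochizuki2012, status: disputed]
— cell abc-iut, GAP B = G-L5t9g8-1, row GB-06 of `plan/GAP-ITEMS.tsv` (ruled decl
`theorem CriticalLocus.clauseAGeom : ClauseAGeom …`, spec sketch `GapSizingBSketch.lean` :74).

Companion BY NAME over landed files: the mathematics is `KappaCoricRatGaloisClauseAGeom.lean`
(★ p668296: `CriticalLocus.mapsTo_isInftyKappaCoricIn_of_isAlgClosed` — base-change stability of
`∞κ`-coricity with geometric divisors); the binders are GB-03's `BaseChangeSquare` (fields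
`φ, ψ, ψ_C, ψ_X, ι, ι_comm`; ★ p668083), GB-04's `CriticalLocus.critMap` (★ p667712) and GB-01's
`CriticalLocus.infKappaCoricSetIn` (★ p666587). This file only KNITS:

* `CriticalLocus.ClauseAGeom S B : Prop` — VERBATIM the sketch's l.74 (binders `[IsAlgClosed Ω]
  [IsAlgClosed Ω']`: the GEOMETRIC typing of RULINGS #318; the identical body at arbitrary `Ω, Ω'` is
  the refutable `ClauseANaive`, deliberately NOT declared);
* `CriticalLocus.clauseAGeom : ClauseAGeom S B` — PROVED for every square (one line from part 1);
* instances: `RatBaseChange.clauseAGeom_square` (design (A): the `L(t)`-square `square φ` at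
  algebraically closed `L`, `L'`), and — design (B), spec-keeper word 2026-08-28T20:54:45Z —
  `RatBaseChange.mapsTo_iota_minfkSet` / `mapsTo_iota_minfkxSet`: for ANY `φ : L →+* L'` of
  characteristic-`0` fields and any `L`-rational locus `S`, GB-03's `ι = iota φ` carries GB-02's
  carrier `S.minfkSet ⊆ Λ_L` (`‡𝕄_{∞κv}` read over the geometric constants `L̄ ⊂ Λ_L`) into
  `(S.critMap φ).minfkSet ⊆ Λ_{L'}` (and `minfkxSet U` into `minfkxSet U'` for `φ U ⊆ U'`) — no
  algebraic-closedness hypothesis on `L`, `L'` is needed there because the divisors are ALREADY counted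
  over the algebraically closed `L̄`, `L̄'` (`RatBaseChange.isAlgClosed_geomConstants`).

No instance, no notation, no new named fact, no `sorry`; one `def` (a `Prop`). Honest framing: an
undisputed elementary construction at OUR typed model objects (C1 model presentation, RULINGS #316
(i)); nothing here takes a side on [IUTchIII] Cor. 3.12 or asserts anything about abc.
-/

namespace Literature.IUT.HodgeTheaters

open Polynomial Literature.FieldTheory.FunctionField

universe u v w w'

namespace CriticalLocus

/-- **Clause (a) of [IUTchI] Ex. 5.4 (iv), GEOMETRIC typing** (VERBATIM `GapSizingBSketch.lean` :74,
row D5 of GAP-SIZING-B): for a base-change square `B` over ALGEBRAICALLY CLOSED constant fields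
`Ω ↪ Ω'` (geometric divisors; intended `Ω = F̄`, `Ω' =` an algebraic closure of `K_v`, or the
relative closures `L̄ ⊂ Λ_L`), the carrier map `B.ι` (`resKummer`) sends the `∞κ`-coric set of `Λ`
for `S` into the `∞κ`-coric set of `Λ'` for the transported locus `critMap S B.φ` — «the
poly-morphism … is compatible with the `∞κ`-coric structures», membership half. The same body at
arbitrary `Ω, Ω'` (`ClauseANaive`, sketch :66) is refutable (RULINGS #318) and is not declared.
([IUTchI] Ex 5.4 (iv) p.149) [claim: Mochizuki2012, status: disputed] -/
def ClauseAGeom {Ω : Type u} {Ω' : Type v} {Λ : Type w} {Λ' : Type w'} [Field Ω] [Field Ω']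
    [CharZero Ω] [CharZero Ω'] [IsAlgClosed Ω] [IsAlgClosed Ω'] [Field Λ] [Field Λ']
    [Algebra (RatFunc Ω) Λ] [Algebra (RatFunc Ω') Λ'] (S : CriticalLocus Ω)
    (B : BaseChangeSquare Ω Ω' Λ Λ') : Prop :=
  ∀ x ∈ infKappaCoricSetIn S Λ, B.ι x ∈ infKappaCoricSetIn (critMap S B.φ) Λ'

/-- **GB-06: clause (a) holds for EVERY base-change square over algebraically closed constant
fields** — one line from `mapsTo_isInftyKappaCoricIn_of_isAlgClosed` (part 1) at the fields
`ψ_C, ψ_X, ι, ι_comm` of `B` and GB-04's `critMap_pts`. (`[IsAlgClosed Ω']` is carried by the TYPE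
of the statement and not used by the proof.) ([IUTchI] Ex 5.4 (iv) p.149)
[claim: Mochizuki2012, status: disputed] -/
theorem clauseAGeom {Ω : Type u} {Ω' : Type v} {Λ : Type w} {Λ' : Type w'} [Field Ω] [Field Ω']
    [CharZero Ω] [CharZero Ω'] [IsAlgClosed Ω] [IsAlgClosed Ω'] [Field Λ] [Field Λ']
    [Algebra (RatFunc Ω) Λ] [Algebra (RatFunc Ω') Λ'] (S : CriticalLocus Ω)
    (B : BaseChangeSquare Ω Ω' Λ Λ') : ClauseAGeom S B :=
  fun _ hx => mapsTo_isInftyKappaCoricIn_of_isAlgClosed B.ψ_C B.ψ_X (critMap_pts S B.φ) B.ι B.ι_comm hx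

/-- Clause (a) as `Set.MapsTo` (the form the `CoricPair` packaging consumes).
([IUTchI] Ex 5.4 (iv) p.149) [claim: Mochizuki2012, status: disputed] -/
theorem ClauseAGeom.mapsTo {Ω : Type u} {Ω' : Type v} {Λ : Type w} {Λ' : Type w'} [Field Ω]
    [Field Ω'] [CharZero Ω] [CharZero Ω'] [IsAlgClosed Ω] [IsAlgClosed Ω'] [Field Λ] [Field Λ']
    [Algebra (RatFunc Ω) Λ] [Algebra (RatFunc Ω') Λ'] {S : CriticalLocus Ω}
    {B : BaseChangeSquare Ω Ω' Λ Λ'} (h : ClauseAGeom S B) :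
    Set.MapsTo B.ι (infKappaCoricSetIn S Λ) (infKappaCoricSetIn (critMap S B.φ) Λ') :=
  fun _ hx => h _ hx

/-- GB-02's `toGeom` IS GB-04's `critMap` along `L ↪ L̄` (same construction).
([IUTchI] Rmk 3.1.7 (i) p.66) [claim: Mochizuki2012, status: disputed] -/
theorem toGeom_eq_critMap {L : Type u} [Field L] (S : CriticalLocus L) :
    S.toGeom = S.critMap (algebraMap L (geomConstants L)) :=
  rfl

end CriticalLocus

namespace RatBaseChange

open CriticalLocus

variable {L : Type u} {L' : Type v} [Field L] [Field L'] (φ : L →+* L')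

/-- The geometric critical loci are compatible with `ι|_{L̄}`: transporting an `L`-rational locus to
`L'` and then to the geometric constants `L̄'` equals transporting its geometric version `S.toGeom`
along `iotaConstants φ` (because `ι|_{L̄}` extends `φ`, `iotaConstants_algebraMap`).
([IUTchI] Rmk 3.1.7 (i) p.66) [claim: Mochizuki2012, status: disputed] -/
theorem toGeom_critMap_pts (S : CriticalLocus L) :
    (S.critMap φ).toGeom.pts =
      S.toGeom.pts.map ⟨iotaConstants φ, (iotaConstants φ).injective⟩ := by
  ext e
  simp only [mem_toGeom_pts_iff, mem_critMap_pts, Finset.mem_map, Function.Embedding.coeFn_mk]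
  constructor
  · rintro ⟨_, ⟨a, ha, rfl⟩, rfl⟩
    exact ⟨_, ⟨a, ha, rfl⟩, iotaConstants_algebraMap φ a⟩
  · rintro ⟨_, ⟨a, ha, rfl⟩, rfl⟩
    exact ⟨_, ⟨a, ha, rfl⟩, (iotaConstants_algebraMap φ a).symm⟩

variable [CharZero L] [CharZero L']

/-- **Design (A) instance.** (RULINGS #340 (A): available alternative, not the knit of record.) At algebraically closed constant fields `L ↪ L'` (e.g. `F̄ ↪ K̄_v` along a
chosen embedding), clause (a) holds for GB-03's `L(t)`-level square `square φ = (φ, ratFuncMapCoeffs φ,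
iota φ)`: `ι` carries `†𝕄^⊛_{∞κ} = S.infKappaCoricSetIn Λ_L` into `‡𝕄_{∞κv}` for `critMap S φ`.
([IUTchI] Ex 5.4 (iv) p.149) [claim: Mochizuki2012, status: disputed] -/
theorem clauseAGeom_square [IsAlgClosed L] [IsAlgClosed L'] (S : CriticalLocus L) :
    ClauseAGeom S (square φ) :=
  clauseAGeom S (square φ)

/-- **Design (B) instance (RULED: RULINGS #340 (A); spec-keeper word 20:54:45Z): clause (a) at GB-02's carriers, for ANY field
hom `φ : L →+* L'` of characteristic-`0` fields** (e.g. the CANONICAL `F → K_v`; no chosen embedding of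
algebraic closures, no algebraic-closedness of `L`, `L'`): GB-03's `ι = iota φ` carries
`S.minfkSet ⊆ Λ_L` — the `∞κ`-coric elements for the `L`-rational locus `S` read over the geometric
constants `L̄ ⊂ Λ_L` (algebraically closed, `isAlgClosed_geomConstants`) — INTO
`(S.critMap φ).minfkSet ⊆ Λ_{L'}`. Proof: part 1 at the geometric square `geomSquare φ`
(`ι_comm = iota_algebraMap_geom`, base map `iotaConstants φ`, loci by `toGeom_critMap_pts`).
([IUTchI] Ex 5.4 (iv) p.149) [claim: Mochizuki2012, status: disputed] -/
theorem mapsTo_iota_minfkSet (S : CriticalLocus L) :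
    Set.MapsTo (iota φ) S.minfkSet (S.critMap φ).minfkSet := by
  letI : Algebra (RatFunc (geomConstants L)) (ratClosure L) := (geomEmb L).toRingHom.toAlgebra
  letI : Algebra (RatFunc (geomConstants L')) (ratClosure L') := (geomEmb L').toRingHom.toAlgebra
  haveI : IsAlgClosed (geomConstants L) := isAlgClosed_geomConstants
  intro x hx
  exact CriticalLocus.isInftyKappaCoricIn_map_of_isAlgClosed (iotaConstants φ)
    (toGeom_critMap_pts φ S) (iota φ) (iota_algebraMap_geom φ) hx

/-- Design (B), `∞κ×`-side: `ι` carries `S.minfkxSet U` into `(S.critMap φ).minfkxSet U'` whenever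
`φ U ⊆ U'` (e.g. units to units). ([IUTchI] Ex 5.4 (iv) p.149) [claim: Mochizuki2012, status: disputed] -/
theorem mapsTo_iota_minfkxSet (S : CriticalLocus L) {U : Set L} {U' : Set L'}
    (hU : Set.MapsTo φ U U') :
    Set.MapsTo (iota φ) (S.minfkxSet U) ((S.critMap φ).minfkxSet U') := by
  letI : Algebra (RatFunc (geomConstants L)) (ratClosure L) := (geomEmb L).toRingHom.toAlgebra
  letI : Algebra (RatFunc (geomConstants L')) (ratClosure L') := (geomEmb L').toRingHom.toAlgebra
  haveI : IsAlgClosed (geomConstants L) := isAlgClosed_geomConstants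
  have hU' : Set.MapsTo (iotaConstants φ) (algebraMap L (geomConstants L) '' U)
      (algebraMap L' (geomConstants L') '' U') := by
    rintro _ ⟨c, hc, rfl⟩
    exact ⟨φ c, hU hc, (iotaConstants_algebraMap φ c).symm⟩
  intro x hx
  exact CriticalLocus.isInftyKappaUnitCoricIn_map_of_isAlgClosed (iotaConstants φ)
    (toGeom_critMap_pts φ S) (iota φ) (iota_algebraMap_geom φ) hU' hx

/-- Design (B): clause (a) lands inside `‡𝕄_{∞κv} ⊆ ‡𝕄_{∞κ×v}` (GB-02's `minfkSet_subset_minfkxSet`,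
any unit parameter `U' ∋ 1`). ([IUTchI] Ex 5.4 (iv) p.149) [claim: Mochizuki2012, status: disputed] -/
theorem mapsTo_iota_minfkSet_minfkxSet (S : CriticalLocus L) {U' : Set L'} (hU' : (1 : L') ∈ U') :
    Set.MapsTo (iota φ) S.minfkSet ((S.critMap φ).minfkxSet U') :=
  (mapsTo_iota_minfkSet φ S).mono_right ((S.critMap φ).minfkSet_subset_minfkxSet hU')

end RatBaseChange

end Literature.IUT.HodgeTheaters
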